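import Summits.Ventures.LatticeQCDFlow.Scaling.SectorExactAugmentation

/-!
HONEST FRAMING: exact (Metropolis-corrected) sampling algorithms for lattice gauge theory; figures
of merit are autocorrelation/cost numbers at stated couplings and volumes; no continuum-physics
claim.

# SectorFreshStep — SECTOR-FRESHNESS IS CONSERVED PIECE BY PIECE: FOR A LAW `λ` ON `(configuration, stale set)` WITH
# `λ(z[j ↦ v], D)·μ_j(z_j) = λ(z, D)·μ_j(v)` FOR `j ∉ D` AND `v` IN THE SECTOR OF `z_j`, (i) THE ACCEPTED-SWAP PIECE `λ(y_r z', σ_r D')α_r(y_r z')`,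
# (ii) THE REJECTED PIECE `λ(z', D')(1 − α_r(z'))`, (iii) THE EXACT HOT REDRAW AND (iv) EVERY SECTOR-CONFINED STATIONARY COLD UPDATE KEEP THE
# RELATION — BECAUSE UNDER SECTOR-EXACT TRANSPORT THE ACCEPTANCE SEES ONLY THE LABELS (lean-2 GEN-30, ours)

Venture-side (OURS).  Cell `lqcd-flow` (pub-lqcd), unit `pub-lqcd-lean-2-g30`, 2026-08-28.  Chapter Q (item 1 for sector-exact maps on a
general `S`), file 2 — the local conservation laws behind `Scaling/SectorFreshness`, in the manner of `Scaling/DominatedStarFreshStep` (chapter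
M), with two differences: exchangeability is required only WITHIN the sector of the current value (`ℓ v = ℓ z_j`, sectors = fibres of a label map `ℓ : S → L`), and the tags are the
optimistic ones of `Scaling/SectorExactStaleSet` (accepted ⇒ `σ_r`, rejected ⇒ unchanged) — no regeneration weights, no pair detailed
balance: each piece is sector-fresh on its own.  The acceptance enters only through two properties: it ignores coordinates off the edge
(`α_r(z[j ↦ v]) = α_r(z)`, `j ≠ 0, l`) and it depends on the two labels only (sector-exactness, file 1).

## What is proved

* §1 `symm_label` (`φ_r⁻¹` preserves the labels), `sectorExact_symm` (`μ_l(u) = c_r(ℓ u)·μ_0(φ_r⁻¹u)`),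
  **`sfresh_accept_piece`** — `z' ↦ λ(y_r z', σ_r D')·α_r(y_r z')` is sector-fresh at every `j ∉ D'` when `λ(·, σ_r D')` is sector-fresh off `σ_r D'`;
  **`sfresh_reject_piece`** — `z' ↦ λ(z', D')·(1 − α_r(z'))` is sector-fresh at every `j ∉ D'`.
* §2 **`sfresh_hot_update`** — `z' ↦ Σ_u λ(z'[0 ↦ u], D)·μ_0(z'_0)` is sector-fresh at `0` and at every `j ≠ 0` where `λ(·,D)` is;
  **`sfresh_cold_update`** — for a `μ_k`-stationary SECTOR-CONFINED kernel (`M_k(u,v) = 0` unless `ℓ u = ℓ v`) `z' ↦ Σ_u λ(z'[k ↦ u], D)·M_k(u, z'_k)` is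
  sector-fresh at every `j ∉ D` (`k ≠ 0`; at `j = k` the update leaves `λ(·,D)` invariant).

Reading (no numerics implied): within-sector HMC-type cold updates and the exact hot redraw are compatible with the bookkeeping; a cold kernel
that crosses sectors is not (and is not needed: the hub does the crossing).  NOT CLAIMED here: the induction (file 3).  Literature grade
(cell rule): OWN; nothing cited as a fact; no new bib keys.
-/

noncomputable section

open Finset Function
open Literature.Probability.MarkovChains

namespace Summit.Ventures.LatticeQCDFlow.Scaling

variable {S : Type*} [Fintype S] [DecidableEq S] {K m : ℕ} {μ : Fin (K + 1) → S → ℝ} {M : Fin (K + 1) → S → S → ℝ}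

section SFreshStep
variable (κ : Fin m → Fin K) (φ : Fin m → Equiv.Perm S) {L : Type*} (ℓ : S → L)

/-! ## §1 The entry pieces -/

omit [Fintype S] [DecidableEq S] in
/-- `φ_r⁻¹` preserves the labels. [ours] -/
theorem symm_label (hφℓ : ∀ r u, ℓ (φ r u) = ℓ u) (r : Fin m) (u : S) : ℓ ((φ r).symm u) = ℓ u := by
  have h := hφℓ r ((φ r).symm u); rw [Equiv.apply_symm_apply] at h; exact h.symm

omit [Fintype S] [DecidableEq S] in
/-- Sector-exactness read backwards: `μ_l(u) = c_r(ℓ u)·μ_0(φ_r⁻¹ u)` with the SAME constant as for `u`'s label. [ours] -/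
theorem sectorExact_symm (hφℓ : ∀ r u, ℓ (φ r u) = ℓ u) {cL : Fin m → L → ℝ}
    (hexact : ∀ r u, μ (κ r).succ (φ r u) = cL r (ℓ u) * μ 0 u) (r : Fin m) (u : S) :
    μ (κ r).succ u = cL r (ℓ u) * μ 0 ((φ r).symm u) := by
  have h := hexact r ((φ r).symm u)
  rw [Equiv.apply_symm_apply] at h
  rw [h, symm_label φ ℓ hφℓ r u]

omit [Fintype S] [DecidableEq S] in
/-- **THE ACCEPTED-SWAP PIECE IS SECTOR-FRESH:** if `λ(·, σ_r D')` is sector-fresh at every `j ∉ σ_r D'`, then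
`C(z') = λ(y_r z', σ_r D')·α_r(y_r z')` satisfies `C(z'[j ↦ v])·μ_j(z'_j) = C(z')·μ_j(v)` for `j ∉ D'` and `v` in the sector of `z'_j`
(sector-exact maps; `α_r` off-edge-blind and label-determined). [ours] -/
theorem sfresh_accept_piece (hφℓ : ∀ r u, ℓ (φ r u) = ℓ u) {cL : Fin m → L → ℝ} (hcL : ∀ r b, 0 < cL r b)
    (hexact : ∀ r u, μ (κ r).succ (φ r u) = cL r (ℓ u) * μ 0 u)
    {α : Fin m → (Fin (K + 1) → S) → ℝ}
    (hαoff : ∀ (r : Fin m) (z : Fin (K + 1) → S) (j : Fin (K + 1)) (v : S), j ≠ 0 → j ≠ (κ r).succ → α r (update z j v) = α r z)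
    (hαlab : ∀ (r : Fin m) (z z' : Fin (K + 1) → S), ℓ (z 0) = ℓ (z' 0) → ℓ (z (κ r).succ) = ℓ (z' (κ r).succ) → α r z = α r z')
    {lam : (Fin (K + 1) → S) × Finset (Fin (K + 1)) → ℝ} (r : Fin m) {D' : Finset (Fin (K + 1))}
    (hlam : ∀ (z : Fin (K + 1) → S) (j : Fin (K + 1)) (v : S), j ∉ D'.image (Equiv.swap (0 : Fin (K + 1)) (κ r).succ) →
      ℓ v = ℓ (z j) → lam (update z j v, D'.image (Equiv.swap (0 : Fin (K + 1)) (κ r).succ)) * μ j (z j)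
        = lam (z, D'.image (Equiv.swap (0 : Fin (K + 1)) (κ r).succ)) * μ j v)
    {j : Fin (K + 1)} (hj : j ∉ D') (z' : Fin (K + 1) → S) (v : S) (hv : ℓ v = ℓ (z' j)) :
    lam (edgeFlowSwap (φ r) 0 (κ r).succ (update z' j v), D'.image (Equiv.swap (0 : Fin (K + 1)) (κ r).succ))
        * α r (edgeFlowSwap (φ r) 0 (κ r).succ (update z' j v)) * μ j (z' j)
      = lam (edgeFlowSwap (φ r) 0 (κ r).succ z', D'.image (Equiv.swap (0 : Fin (K + 1)) (κ r).succ))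
        * α r (edgeFlowSwap (φ r) 0 (κ r).succ z') * μ j v := by
  have hl0 : (κ r).succ ≠ (0 : Fin (K + 1)) := Fin.succ_ne_zero _
  obtain ⟨hy0, hyl, hyoff⟩ := entrySwap_apply κ φ r z'
  set σD := D'.image (Equiv.swap (0 : Fin (K + 1)) (κ r).succ) with hσD
  set y := edgeFlowSwap (φ r) 0 (κ r).succ z' with hy
  by_cases hjl : j = (κ r).succ
  · -- `j = l`: the update lands at the hub of the proposal
    subst hjl
    have h0σ : (0 : Fin (K + 1)) ∉ σD := by
      rw [hσD, mem_swapImage_iff κ r D' 0, Equiv.swap_apply_left]; exact hj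
    rw [entrySwap_update_snd κ φ r z' v]
    have hlabv : ℓ ((φ r).symm v) = ℓ (y 0) := by
      rw [hy0, symm_label φ ℓ hφℓ, symm_label φ ℓ hφℓ]; exact hv
    have hαeq : α r (update y 0 ((φ r).symm v)) = α r y :=
      hαlab r _ _ (by rw [update_self]; exact hlabv) (by rw [update_of_ne hl0])
    have h := hlam y 0 ((φ r).symm v) h0σ hlabv
    rw [hy0] at h
    -- convert `μ_0(φ⁻¹ ·)` into `μ_l(·)` with the common constant of the label
    set c := cL r (ℓ v) with hc
    have hcpos : 0 < c := hcL r _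
    have hμv : μ (κ r).succ v = c * μ 0 ((φ r).symm v) := sectorExact_symm κ φ ℓ hφℓ hexact r v
    have hμz : μ (κ r).succ (z' (κ r).succ) = c * μ 0 ((φ r).symm (z' (κ r).succ)) := by
      rw [sectorExact_symm κ φ ℓ hφℓ hexact r (z' (κ r).succ), ← hv]
    rw [hαeq, hμv, hμz]
    calc lam (update y 0 ((φ r).symm v), σD) * α r y * (c * μ 0 ((φ r).symm (z' (κ r).succ)))
        = (lam (update y 0 ((φ r).symm v), σD) * μ 0 ((φ r).symm (z' (κ r).succ))) * (α r y * c) := by ring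
      _ = (lam (y, σD) * μ 0 ((φ r).symm v)) * (α r y * c) := by rw [h]
      _ = lam (y, σD) * α r y * (c * μ 0 ((φ r).symm v)) := by ring
  · by_cases hj0 : j = 0
    · -- `j = 0`: the update lands at the cold end of the proposal
      subst hj0
      have hlσ : (κ r).succ ∉ σD := by
        rw [hσD, mem_swapImage_iff κ r D' (κ r).succ, Equiv.swap_apply_right]; exact hj
      rw [entrySwap_update_fst κ φ r z' v]
      have hlabv : ℓ (φ r v) = ℓ (y (κ r).succ) := by
        rw [hyl, hφℓ, hφℓ]; exact hv
      have hαeq : α r (update y (κ r).succ (φ r v)) = α r y :=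
        hαlab r _ _ (by rw [update_of_ne hl0.symm]) (by rw [update_self]; exact hlabv)
      have h := hlam y (κ r).succ (φ r v) hlσ hlabv
      rw [hyl] at h
      set c := cL r (ℓ v) with hc
      have hcpos : 0 < c := hcL r _
      have hμv : μ (κ r).succ (φ r v) = c * μ 0 v := hexact r v
      have hμz : μ (κ r).succ (φ r (z' 0)) = c * μ 0 (z' 0) := by rw [hexact r (z' 0), ← hv]
      rw [hμv, hμz] at h
      rw [hαeq]
      have h' : lam (update y (κ r).succ (φ r v), σD) * μ 0 (z' 0) = lam (y, σD) * μ 0 v := by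
        have := h
        rw [← mul_assoc, ← mul_assoc, mul_comm (lam _) c, mul_comm (lam _) c, mul_assoc, mul_assoc] at this
        exact mul_left_cancel₀ hcpos.ne' this
      calc lam (update y (κ r).succ (φ r v), σD) * α r y * μ 0 (z' 0)
          = (lam (update y (κ r).succ (φ r v), σD) * μ 0 (z' 0)) * α r y := by ring
        _ = (lam (y, σD) * μ 0 v) * α r y := by rw [h']
        _ = lam (y, σD) * α r y * μ 0 v := by ring
    · -- `j` off the edge
      have hjσ : j ∉ σD := by
        rw [hσD, mem_swapImage_iff κ r D' j, Equiv.swap_apply_of_ne_of_ne hj0 hjl]; exact hj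
      rw [entrySwap_update_of_ne κ φ r z' hj0 hjl v, hαoff r y j v hj0 hjl]
      have hlabv : ℓ v = ℓ (y j) := by rw [hyoff j hj0 hjl]; exact hv
      have h := hlam y j v hjσ hlabv
      rw [hyoff j hj0 hjl] at h
      calc lam (update y j v, σD) * α r y * μ j (z' j) = (lam (update y j v, σD) * μ j (z' j)) * α r y := by ring
        _ = (lam (y, σD) * μ j v) * α r y := by rw [h]
        _ = lam (y, σD) * α r y * μ j v := by ring

omit [Fintype S] [DecidableEq S] in
/-- **THE REJECTED PIECE IS SECTOR-FRESH:** `C(z') = λ(z', D')·(1 − α_r(z'))` satisfies `C(z'[j ↦ v])·μ_j(z'_j) = C(z')·μ_j(v)` for `j ∉ D'`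
and `v` in the sector of `z'_j` — a rejection carries no information beyond the labels. [ours] -/
theorem sfresh_reject_piece {α : Fin m → (Fin (K + 1) → S) → ℝ}
    (hαoff : ∀ (r : Fin m) (z : Fin (K + 1) → S) (j : Fin (K + 1)) (v : S), j ≠ 0 → j ≠ (κ r).succ → α r (update z j v) = α r z)
    (hαlab : ∀ (r : Fin m) (z z' : Fin (K + 1) → S), ℓ (z 0) = ℓ (z' 0) → ℓ (z (κ r).succ) = ℓ (z' (κ r).succ) → α r z = α r z')
    {lam : (Fin (K + 1) → S) × Finset (Fin (K + 1)) → ℝ} (r : Fin m) {D' : Finset (Fin (K + 1))}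
    (hlam : ∀ (z : Fin (K + 1) → S) (j : Fin (K + 1)) (v : S), j ∉ D' → ℓ v = ℓ (z j) →
      lam (update z j v, D') * μ j (z j) = lam (z, D') * μ j v)
    {j : Fin (K + 1)} (hj : j ∉ D') (z' : Fin (K + 1) → S) (v : S) (hv : ℓ v = ℓ (z' j)) :
    lam (update z' j v, D') * (1 - α r (update z' j v)) * μ j (z' j) = lam (z', D') * (1 - α r z') * μ j v := by
  have hl0 : (κ r).succ ≠ (0 : Fin (K + 1)) := Fin.succ_ne_zero _
  have hαeq : α r (update z' j v) = α r z' := by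
    by_cases hj0 : j = 0
    · subst hj0
      exact hαlab r _ _ (by rw [update_self]; exact hv) (by rw [update_of_ne hl0])
    · by_cases hjl : j = (κ r).succ
      · subst hjl
        exact hαlab r _ _ (by rw [update_of_ne hl0.symm]) (by rw [update_self]; exact hv)
      · exact hαoff r z' j v hj0 hjl
  rw [hαeq]
  have h := hlam z' j v hj hv
  calc lam (update z' j v, D') * (1 - α r z') * μ j (z' j) = (lam (update z' j v, D') * μ j (z' j)) * (1 - α r z') := by ring
    _ = (lam (z', D') * μ j v) * (1 - α r z') := by rw [h]
    _ = lam (z', D') * (1 - α r z') * μ j v := by ring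

/-! ## §2 The update pieces -/

omit [DecidableEq S] in
/-- **THE EXACT HOT REDRAW KEEPS SECTOR-FRESHNESS:** `T(z') = Σ_u λ(z'[0 ↦ u], D)·μ_0(z'_0)` satisfies `T(z'[j ↦ v])·μ_j(z'_j) = T(z')·μ_j(v)`
at `j = 0` (any `v`), and at every `j ≠ 0` at which `λ(·, D)` is sector-fresh, for `v` in the sector of `z'_j`. [ours] -/
theorem sfresh_hot_update {lam : (Fin (K + 1) → S) × Finset (Fin (K + 1)) → ℝ} {D : Finset (Fin (K + 1))} {j : Fin (K + 1)}
    (hlamj : j ≠ 0 → ∀ (z : Fin (K + 1) → S) (v : S), ℓ v = ℓ (z j) → lam (update z j v, D) * μ j (z j) = lam (z, D) * μ j v)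
    (z' : Fin (K + 1) → S) (v : S) (hv : j ≠ 0 → ℓ v = ℓ (z' j)) :
    (∑ u : S, lam (update (update z' j v) 0 u, D) * μ 0 (update z' j v 0)) * μ j (z' j)
      = (∑ u : S, lam (update z' 0 u, D) * μ 0 (z' 0)) * μ j v := by
  by_cases hj : j = 0
  · subst hj
    simp_rw [update_idem, update_self]
    rw [Finset.sum_mul, Finset.sum_mul]
    exact sum_congr rfl fun u _ => by ring
  · rw [update_of_ne (Ne.symm hj), Finset.sum_mul, Finset.sum_mul]
    refine sum_congr rfl fun u _ => ?_
    rw [update_comm hj]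
    have h := hlamj hj (update z' 0 u) v (by rw [update_of_ne hj]; exact hv hj)
    rw [update_of_ne hj] at h
    calc lam (update (update z' 0 u) j v, D) * μ 0 (z' 0) * μ j (z' j)
        = (lam (update (update z' 0 u) j v, D) * μ j (z' j)) * μ 0 (z' 0) := by ring
      _ = (lam (update z' 0 u, D) * μ j v) * μ 0 (z' 0) := by rw [h]
      _ = lam (update z' 0 u, D) * μ 0 (z' 0) * μ j v := by ring

omit [DecidableEq S] in
/-- **A SECTOR-CONFINED STATIONARY COLD UPDATE KEEPS SECTOR-FRESHNESS:** with `Σ_u μ_k(u)M_k(u,v) = μ_k(v)`, `M_k(u,v) = 0` across sectors,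
and `λ(·, D)` sector-fresh at every `j ∉ D`, `T(z') = Σ_u λ(z'[k ↦ u], D)·M_k(u, z'_k)` satisfies `T(z'[j ↦ v])·μ_j(z'_j) = T(z')·μ_j(v)` for
every `j ∉ D` and `v` in the sector of `z'_j` (`μ_k > 0`). [ours] -/
theorem sfresh_cold_update (hμ : ∀ k x, 0 < μ k x) {k : Fin (K + 1)} (hstat : ∀ v, ∑ u, μ k u * M k u v = μ k v)
    (hconf : ∀ u v, ℓ u ≠ ℓ v → M k u v = 0)
    {lam : (Fin (K + 1) → S) × Finset (Fin (K + 1)) → ℝ} {D : Finset (Fin (K + 1))}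
    (hlam : ∀ (z : Fin (K + 1) → S) (j : Fin (K + 1)) (v : S), j ∉ D → ℓ v = ℓ (z j) →
      lam (update z j v, D) * μ j (z j) = lam (z, D) * μ j v)
    (z' : Fin (K + 1) → S) {j : Fin (K + 1)} (hj : j ∉ D) (v : S) (hv : ℓ v = ℓ (z' j)) :
    (∑ u : S, lam (update (update z' j v) k u, D) * M k u (update z' j v k)) * μ j (z' j)
      = (∑ u : S, lam (update z' k u, D) * M k u (z' k)) * μ j v := by
  by_cases hjk : j = k
  · subst hjk
    simp_rw [update_idem, update_self]
    have hz : 0 < μ j (z' j) := hμ _ _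
    -- within the sector: `λ(z'[j ↦ u], D) = λ(z', D)·μ_j(u)/μ_j(z'_j)`; across: the kernel vanishes
    have key : ∀ u w : S, ℓ w = ℓ (z' j) →
        lam (update z' j u, D) * M j u w = lam (z', D) * μ j u / μ j (z' j) * M j u w := by
      intro u w hw
      by_cases hu : ℓ u = ℓ (z' j)
      · rw [show lam (update z' j u, D) = lam (z', D) * μ j u / μ j (z' j) by
          rw [eq_div_iff hz.ne']; exact hlam z' j u hj hu]
      · have : M j u w = 0 := hconf u w fun h => hu (h.trans hw)
        rw [this, mul_zero, mul_zero]
    rw [Finset.sum_congr rfl fun u _ => key u v hv, Finset.sum_congr rfl fun u _ => key u (z' j) rfl]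
    have e1 : ∑ u, lam (z', D) * μ j u / μ j (z' j) * M j u v = lam (z', D) / μ j (z' j) * ∑ u, μ j u * M j u v := by
      rw [Finset.mul_sum]; exact sum_congr rfl fun u _ => by ring
    have e2 : ∑ u, lam (z', D) * μ j u / μ j (z' j) * M j u (z' j) = lam (z', D) / μ j (z' j) * ∑ u, μ j u * M j u (z' j) := by
      rw [Finset.mul_sum]; exact sum_congr rfl fun u _ => by ring
    rw [e1, e2, hstat, hstat]
    field_simp
  · rw [update_of_ne (Ne.symm hjk), Finset.sum_mul, Finset.sum_mul]
    refine sum_congr rfl fun u _ => ?_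
    rw [update_comm hjk]
    have h := hlam (update z' k u) j v hj (by rw [update_of_ne hjk]; exact hv)
    rw [update_of_ne hjk] at h
    calc lam (update (update z' k u) j v, D) * M k u (z' k) * μ j (z' j)
        = (lam (update (update z' k u) j v, D) * μ j (z' j)) * M k u (z' k) := by ring
      _ = (lam (update z' k u, D) * μ j v) * M k u (z' k) := by rw [h]
      _ = lam (update z' k u, D) * M k u (z' k) * μ j v := by ring

end SFreshStep

end Summit.Ventures.LatticeQCDFlow.Scaling

end
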